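import Literature.Analysis.FluidPDE.OseenHeatPairing
import HarnessLib

/-!
# The Oseen–heat operator `𝒩_τ = e^{τΔ} P ∇·` is weakly divergence free

Analysis/FluidPDE support file, companion of `OseenHeatPairing.lean` (second layer of the
discharge of the named fact `Literature.Analysis.FluidPDE.classical_of_bounded_mild_L3`,
`MildL3Smooth.lean`; Lemarié-Rieusset 2016, Thm. 9.12; Koch–Nadirashvili–Seregin–Šverák 2009,
§4). For a bounded matrix field `F = (Fⱼₖ)` on a three-dimensional inner product space, `τ > 0`
and a smooth compactly supported scalar `θ`,

  `∫ ∑ᵢ (𝒩_τ F)ᵢ ∂ᵢθ = 0`   (`integral_sum_oseenHeat_mul_fderiv_eq_zero`),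

i.e. `div (e^{τΔ} P ∇·F) = 0` in the sense of distributions — the statement that makes the
Duhamel term of the Oseen formula weakly divergence free, as required by the Helmholtz–Weyl
annihilator lemma (`HelmholtzAnnihilator.lean`) which identifies a duality-form mild solution
with its Oseen/Duhamel representative.

Proof: with the skew-adjointness of the layers (`OseenHeatPairing.lean`) the first-order part
is `-∑ⱼₖ ∫ Fⱼₖ ∂ⱼ∂ₖ e^{τΔ}θ`, and the Leray correction is
`-∑ⱼₖ ∫₀^∞ (∫ Fⱼₖ ∂ₖ∂ⱼ e^{(τ+σ)Δ} Δθ) dσ` (`sum_integral_heatD3_mul_fderiv_eq`); since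
`∂ₖ∂ⱼ e^{sΔ}Δθ = ∂ₛ ∂ₖ∂ⱼ e^{sΔ}θ` (heat equation with the Laplacian on the test data) and
`‖∂ₖ∂ⱼ e^{sΔ}θ‖₁ ≤ 18 s⁻¹‖θ‖₁ → 0`, the correction time integrates out to
`+∑ⱼₖ ∫ Fⱼₖ ∂ₖ∂ⱼ e^{τΔ}θ` (`integral_Ioi_integral_mul_heatD2_laplacian`: Fubini on `E × (0, L]`
and `L → ∞`), which cancels the first-order part by the symmetry of second derivatives.
Everything is proved; no definitions.

## Mathlib / tree search

Tree: `OseenHeatPairing` (`integral_heatD1_mul_eq_neg_integral`, `heatD2_eq_heatExtension`,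
`heatD1_fderiv_eq_heatD2`, `heatD2_comm_of_test`, `sum_integral_heatD3_mul_fderiv_eq`,
`integral_integral_Ioi_heatD3_mul_eq`), `OseenHeat*` (`heatD2_eq_heatD1_heatD1`,
`eLpNorm_heatD1_le_dim3`, `memLp_top_oseenHeat`, `memLp_top_integral_Ioi_heatD3`),
`UnboundedOperators.hasDerivAt_heatExtension_time_of_hasCompactSupport`,
`continuousOn_uncurry_heatExtension_of_memLp`, `lintegral_enorm_heatExtension_le`,
`fderiv_laplacian_apply` (`HelmholtzAnnihilator`). Mathlib: `integrable_prod_iff'`,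
`integral_integral_swap`, `intervalIntegral.integral_eq_sub_of_hasDerivAt`,
`intervalIntegral_tendsto_integral_Ioi`, `tendsto_nhds_unique`, `ae_le_eLpNormEssSup`.
`lean search 'oseenHeat.*fderiv_eq_zero|heatD2_laplacian'`: nothing prior.

## References

* P. G. Lemarié-Rieusset, *The Navier–Stokes Problem in the 21st Century*, CRC Press 2016,
  §6.2 (Oseen tensor `O_{jk} = δ_{jk}W + G ∗ ∂ⱼ∂ₖW`), Thm. 9.12. [LemarieRieusset2016]
* G. Koch, N. Nadirashvili, G. Seregin, V. Šverák, Acta Math. 203 (2009) = arXiv:0709.3599, §3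
  (mild solutions of the linear Stokes problem are divergence free). [KochNadirashviliSereginSverak2009]
-/

open MeasureTheory Filter Set InnerProductSpace intervalIntegral
open scoped Real ENNReal NNReal Convolution Laplacian RealInnerProductSpace Topology

noncomputable section

namespace Literature.Analysis.FluidPDE

variable {E : Type*} [NormedAddCommGroup E] [InnerProductSpace ℝ E] [FiniteDimensional ℝ E]
  [MeasurableSpace E] [BorelSpace E]

/-! ## Smoothness and support of the Laplacian of a test function (frame-sum form) -/

section LaplacianAux

omit [InnerProductSpace ℝ E] [FiniteDimensional ℝ E] [MeasurableSpace E] [BorelSpace E] in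
/-- A finite sum of compactly supported functions is compactly supported. [folklore] -/
private theorem hasCompactSupport_finsetSum' {E' : Type*} [TopologicalSpace E'] {ι : Type*}
    (s : Finset ι) {f : ι → E' → ℝ} (h : ∀ i ∈ s, HasCompactSupport (f i)) :
    HasCompactSupport fun x => ∑ i ∈ s, f i x := by
  classical
  induction s using Finset.induction_on with
  | empty =>
    simp only [Finset.sum_empty]
    exact (HasCompactSupport.zero : HasCompactSupport (0 : E' → ℝ))
  | insert a s ha ih =>
    simp_rw [Finset.sum_insert ha]
    exact (h a (Finset.mem_insert_self a s)).add
      (ih fun i hi => h i (Finset.mem_insert_of_mem hi))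

omit [MeasurableSpace E] [BorelSpace E] in
/-- The Laplacian of a smooth function is smooth (frame-sum representation; a private copy of
the tree's `contDiff_laplacian`, whose module is not imported here). [folklore] -/
private theorem contDiff_laplacian_aux' {θ : E → ℝ} (hθ : ContDiff ℝ ((⊤ : ℕ∞) : WithTop ℕ∞) θ)
    (n : ℕ) : ContDiff ℝ n (Δ θ) := by
  have h2 : ContDiff ℝ 2 θ := contDiff_infty.1 hθ 2
  have hn : ContDiff ℝ (n + 2 : ℕ) θ := contDiff_infty.1 hθ (n + 2)
  rw [show (Δ θ) = fun y => ∑ i, fderiv ℝ (fun y' => fderiv ℝ θ y' (stdOrthonormalBasis ℝ E i))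
      y (stdOrthonormalBasis ℝ E i) from funext (laplacian_eq_sum_fderiv_fderiv _ h2)]
  refine ContDiff.sum fun i _ => ?_
  have h1 : ContDiff ℝ (n + 1 : ℕ) fun y' => fderiv ℝ θ y' (stdOrthonormalBasis ℝ E i) :=
    contDiff_fderiv_apply_const_of_succ (n := n + 1) hn _
  exact contDiff_fderiv_apply_const_of_succ h1 _

omit [MeasurableSpace E] [BorelSpace E] in
/-- The Laplacian of a compactly supported `C²` function is compactly supported (a private copy
of the tree's `hasCompactSupport_laplacian`). [folklore] -/
private theorem hasCompactSupport_laplacian_aux' {θ : E → ℝ} (hθ : ContDiff ℝ 2 θ)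
    (hc : HasCompactSupport θ) : HasCompactSupport (Δ θ) := by
  rw [show (Δ θ) = fun y => ∑ i, fderiv ℝ (fun y' => fderiv ℝ θ y' (stdOrthonormalBasis ℝ E i))
      y (stdOrthonormalBasis ℝ E i) from funext (laplacian_eq_sum_fderiv_fderiv _ hθ)]
  exact hasCompactSupport_finsetSum' _ fun i _ => (hc.fderiv_apply ℝ _).fderiv_apply ℝ _

end LaplacianAux

/-! ## Weak divergence-freeness of `𝒩_τ F` -/

section DivFree

/-- A.e. pointwise bound of an `L^∞` function by its norm. [folklore] -/
theorem ae_norm_le_toReal_eLpNorm_top {G : E → ℝ} (hG : MemLp G ∞ volume) :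
    ∀ᵐ x ∂(volume : Measure E), ‖G x‖ ≤ (eLpNorm G ∞ volume).toReal := by
  filter_upwards [ae_le_eLpNormEssSup (f := G) (μ := (volume : Measure E))] with x hx
  rw [← eLpNorm_exponent_top] at hx
  calc ‖G x‖ = ‖G x‖ₑ.toReal := (toReal_enorm _).symm
    _ ≤ (eLpNorm G ∞ volume).toReal := ENNReal.toReal_mono hG.eLpNorm_ne_top hx

/-- The `L^∞`–`L¹` pairing bound `|∫ G h| ≤ ‖G‖_∞ ‖h‖₁`, and `∫ |G h| ≤ ‖G‖_∞ ‖h‖₁`. [folklore] -/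
theorem integral_norm_mul_le_of_top {G h : E → ℝ} (hG : MemLp G ∞ volume) (hh : Integrable h) :
    ∫ x, ‖G x * h x‖ ≤ (eLpNorm G ∞ volume).toReal * ∫ x, ‖h x‖ := by
  rw [← MeasureTheory.integral_const_mul]
  refine integral_mono_ae (hh.mul_of_top_right hG).norm (hh.norm.const_mul _) ?_
  filter_upwards [ae_norm_le_toReal_eLpNorm_top hG] with x hx
  rw [norm_mul]
  exact mul_le_mul_of_nonneg_right hx (norm_nonneg _)

/-- `|∫ G h| ≤ ‖G‖_∞ ‖h‖₁` for `G ∈ L^∞`, `h ∈ L¹`. [folklore] -/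
theorem norm_integral_mul_le_of_top {G h : E → ℝ} (hG : MemLp G ∞ volume) (hh : Integrable h) :
    ‖∫ x, G x * h x‖ ≤ (eLpNorm G ∞ volume).toReal * ∫ x, ‖h x‖ :=
  (MeasureTheory.norm_integral_le_integral_norm _).trans (integral_norm_mul_le_of_top hG hh)

/-- Real-integral form of the `L¹` contraction of the heat flow for integrable data:
`∫ |e^{sΔ}h| ≤ ∫ |h|` (the tree's `integral_norm_heatExtension_le` in `HeatDuhamelBack` is the
continuous compactly supported case; not imported here). [folklore] -/
theorem integral_norm_heatExtension_le_of_integrable {h : E → ℝ} (hh : Integrable h) {s : ℝ} (hs : 0 < s) :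
    ∫ x, ‖UnboundedOperators.heatExtension h s x‖ ≤ ∫ x, ‖h x‖ := by
  rw [integral_norm_eq_lintegral_enorm (UnboundedOperators.integrable_heatExtension hh hs).1,
    integral_norm_eq_lintegral_enorm hh.1]
  exact ENNReal.toReal_mono hh.2.ne (UnboundedOperators.lintegral_enorm_heatExtension_le hh hs)

variable (hE : Module.finrank ℝ E = 3)
include hE

/-- `L¹` decay of the second heat-flow layer at the frame vectors in dimension three:
`‖∂ₖ∂ⱼ e^{sΔ} θ‖₁ ≤ 18 s⁻¹ ‖θ‖₁` (two `D¹` layers at the clock `s/2`). [folklore] -/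
theorem eLpNorm_one_heatD2_frame_le {θ : E → ℝ} (hθ : Integrable θ) {s : ℝ} (hs : 0 < s)
    (j k : Fin (Module.finrank ℝ E)) :
    eLpNorm (heatD2 s (stdOrthonormalBasis ℝ E k) (stdOrthonormalBasis ℝ E j) θ) 1 volume ≤
      ENNReal.ofReal (18 * s⁻¹) * eLpNorm θ 1 volume := by
  set b := stdOrthonormalBasis ℝ E
  have hθ1 : MemLp θ 1 volume := memLp_one_iff_integrable.2 hθ
  have h2 : 0 < s / 2 := by positivity
  have hsplit := heatD2_eq_heatD1_heatD1 hθ1 le_rfl h2 h2 (b k) (b j)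
  rw [show s / 2 + s / 2 = s by ring] at hsplit
  rw [hsplit]
  have hψ : MemLp (heatD1 (s / 2) (b j) θ) 1 volume := memLp_heatD1 hθ1 le_rfl h2 (b j)
  have h1 := eLpNorm_heatD1_le_dim3 hE hψ le_rfl h2 (norm_stdOrthonormalBasis_le_one k)
  have h1' := eLpNorm_heatD1_le_dim3 hE hθ1 le_rfl h2 (norm_stdOrthonormalBasis_le_one j)
  have hr : (s / 2) ^ (-(1 / 2) : ℝ) * (s / 2) ^ (-(1 / 2) : ℝ) = 2 * s⁻¹ := by
    rw [← Real.rpow_add h2]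
    norm_num
    rw [Real.rpow_neg_one]
    field_simp
  calc eLpNorm (heatD1 (s / 2) (b k) (heatD1 (s / 2) (b j) θ)) 1 volume
      ≤ ENNReal.ofReal (3 * (s / 2) ^ (-(1 / 2) : ℝ)) * eLpNorm (heatD1 (s / 2) (b j) θ) 1 volume := h1
    _ ≤ ENNReal.ofReal (3 * (s / 2) ^ (-(1 / 2) : ℝ)) *
        (ENNReal.ofReal (3 * (s / 2) ^ (-(1 / 2) : ℝ)) * eLpNorm θ 1 volume) := by gcongr
    _ = ENNReal.ofReal (18 * s⁻¹) * eLpNorm θ 1 volume := by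
        rw [← mul_assoc, ← ENNReal.ofReal_mul (by positivity)]
        congr 2
        calc 3 * (s / 2) ^ (-(1 / 2) : ℝ) * (3 * (s / 2) ^ (-(1 / 2) : ℝ))
            = 9 * ((s / 2) ^ (-(1 / 2) : ℝ) * (s / 2) ^ (-(1 / 2) : ℝ)) := by ring
          _ = 18 * s⁻¹ := by rw [hr]; ring

/-- Real-integral form: `∫ |∂ₖ∂ⱼ e^{sΔ} θ| ≤ 18 s⁻¹ ∫ |θ|`. [folklore] -/
theorem integral_norm_heatD2_frame_le {θ : E → ℝ} (hθ : Integrable θ) {s : ℝ} (hs : 0 < s)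
    (j k : Fin (Module.finrank ℝ E)) :
    ∫ x, ‖heatD2 s (stdOrthonormalBasis ℝ E k) (stdOrthonormalBasis ℝ E j) θ x‖ ≤
      18 * s⁻¹ * ∫ x, ‖θ x‖ := by
  set b := stdOrthonormalBasis ℝ E
  have hθ1 : MemLp θ 1 volume := memLp_one_iff_integrable.2 hθ
  have hD : MemLp (heatD2 s (b k) (b j) θ) 1 volume := by
    have h2 : 0 < s / 2 := by positivity
    have hsplit := heatD2_eq_heatD1_heatD1 hθ1 le_rfl h2 h2 (b k) (b j)
    rw [show s / 2 + s / 2 = s by ring] at hsplit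
    rw [hsplit]
    exact memLp_heatD1 (memLp_heatD1 hθ1 le_rfl h2 (b j)) le_rfl h2 (b k)
  have h := eLpNorm_one_heatD2_frame_le hE hθ hs j k
  rw [integral_norm_eq_lintegral_enorm hD.1, integral_norm_eq_lintegral_enorm hθ.1,
    ← eLpNorm_one_eq_lintegral_enorm, ← eLpNorm_one_eq_lintegral_enorm]
  have hfin : eLpNorm θ 1 volume ≠ ∞ := hθ1.eLpNorm_ne_top
  have := ENNReal.toReal_mono (ENNReal.mul_ne_top ENNReal.ofReal_ne_top hfin) h
  rwa [ENNReal.toReal_mul, ENNReal.toReal_ofReal (by positivity)] at this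

/-- **Integrating out the correction time against the Laplacian of a test function.** For
`G ∈ L^∞`, `τ > 0`, a smooth compactly supported `θ` and frame indices `j, k`: since
`∂ₖ∂ⱼ e^{sΔ} (Δθ) = ∂ₛ ∂ₖ∂ⱼ e^{sΔ} θ` (heat equation, derivatives on the data) and
`‖∂ₖ∂ⱼ e^{sΔ}θ‖₁ → 0` as `s → ∞` (`integral_norm_heatD2_frame_le`),
`∫₀^∞ (∫ G ∂ₖ∂ⱼ e^{(τ+σ)Δ} Δθ) dσ = -∫ G ∂ₖ∂ⱼ e^{τΔ} θ`, provided the outer integrand is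
integrable on `(0, ∞)` (Fubini on `E × (0, L]`, then `L → ∞`). [folklore] -/
theorem integral_Ioi_integral_mul_heatD2_laplacian {G : E → ℝ} (hG : MemLp G ∞ volume)
    {τ : ℝ} (hτ : 0 < τ) {θ : E → ℝ}
    (hθ : FunctionSpaces.IsTestFunctionOn (⊤ : TopologicalSpace.Opens E) θ)
    (j k : Fin (Module.finrank ℝ E))
    (hV : IntegrableOn (fun σ => ∫ x, G x * heatD2 (τ + σ) (stdOrthonormalBasis ℝ E k)
      (stdOrthonormalBasis ℝ E j) (Δ θ) x) (Ioi 0)) :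
    ∫ σ in Ioi (0 : ℝ), ∫ x, G x * heatD2 (τ + σ) (stdOrthonormalBasis ℝ E k)
        (stdOrthonormalBasis ℝ E j) (Δ θ) x =
      -∫ x, G x * heatD2 τ (stdOrthonormalBasis ℝ E k) (stdOrthonormalBasis ℝ E j) θ x := by
  set b := stdOrthonormalBasis ℝ E with hb
  -- the data `g = ∂ₖ∂ⱼθ`, its Laplacian, and the heat flows `e^{sΔ}g`, `e^{sΔ}Δg`
  have hθ2 : ContDiff ℝ 2 θ := contDiff_infty.1 hθ.contDiff 2
  have hθ3 : ContDiff ℝ 3 θ := contDiff_infty.1 hθ.contDiff 3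
  have hθ4 : ContDiff ℝ 4 θ := contDiff_infty.1 hθ.contDiff 4
  have hθi : Integrable θ := hθ.contDiff.continuous.integrable_of_hasCompactSupport hθ.hasCompactSupport
  set g : E → ℝ := fun z => fderiv ℝ (fun y => fderiv ℝ θ y (b j)) z (b k) with hg
  have hθv3 : ContDiff ℝ 3 fun y => fderiv ℝ θ y (b j) := contDiff_fderiv_apply_const_of_succ hθ4 _
  have hg2 : ContDiff ℝ 2 g := contDiff_fderiv_apply_const_of_succ hθv3 _
  have hgc : HasCompactSupport g := (hθ.hasCompactSupport.fderiv_apply ℝ _).fderiv_apply ℝ _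
  have hΔθ2 : ContDiff ℝ 2 (Δ θ) := contDiff_laplacian_aux' hθ.contDiff 2
  have hΔθc : HasCompactSupport (Δ θ) := hasCompactSupport_laplacian_aux' hθ2 hθ.hasCompactSupport
  have hΔgc : HasCompactSupport (Δ g) := hasCompactSupport_laplacian_aux' hg2 hgc
  have hΔgcont : Continuous (Δ g) := continuous_laplacian hg2
  have hΔgint : Integrable (Δ g) := hΔgcont.integrable_of_hasCompactSupport hΔgc
  have hΔgm : MemLp (Δ g) ∞ volume := hΔgcont.memLp_top_of_hasCompactSupport hΔgc _
  have hU : ∀ s, heatD2 s (b k) (b j) θ = UnboundedOperators.heatExtension g s := fun s =>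
    heatD2_eq_heatExtension hθ2 hθ.hasCompactSupport s (b j) (b k)
  have hΔg : (Δ g) = fun z => fderiv ℝ (fun y => fderiv ℝ (Δ θ) y (b j)) z (b k) := by
    funext z
    rw [show (fun y => fderiv ℝ (Δ θ) y (b j)) = Δ (fun y => fderiv ℝ θ y (b j)) from
      funext fun y => fderiv_laplacian_apply hθ3 y (b j)]
    exact (fderiv_laplacian_apply hθv3 z (b k)).symm
  have hW : ∀ s, heatD2 s (b k) (b j) (Δ θ) = UnboundedOperators.heatExtension (Δ g) s := fun s => by
    rw [heatD2_eq_heatExtension hΔθ2 hΔθc s (b j) (b k), hΔg]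
  -- the heat equation in the correction time and the FTC on `[0, L]`
  have hderiv : ∀ σ, 0 ≤ σ → ∀ x, HasDerivAt (fun σ' => UnboundedOperators.heatExtension g (τ + σ') x)
      (UnboundedOperators.heatExtension (Δ g) (τ + σ) x) σ := by
    intro σ hσ x
    have h := UnboundedOperators.hasDerivAt_heatExtension_time_of_hasCompactSupport hg2 hgc
      (σ := τ + σ) (by linarith) x
    exact h.comp_const_add τ σ
  have hFTC : ∀ L, 0 ≤ L → ∀ x, UnboundedOperators.heatExtension g (τ + L) x -
      UnboundedOperators.heatExtension g τ x =
        ∫ σ in (0:ℝ)..L, UnboundedOperators.heatExtension (Δ g) (τ + σ) x := by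
    intro L hL x
    have hcont : ContinuousOn (fun σ => UnboundedOperators.heatExtension (Δ g) (τ + σ) x) (Icc 0 L) :=
      (UnboundedOperators.continuousOn_heatExtension_time hΔgm le_top x).comp
        (continuous_const.add continuous_id).continuousOn
        (fun σ hσ => show τ + σ ∈ Ioi 0 from by
          have : 0 ≤ σ := hσ.1
          simp only [mem_Ioi]; linarith)
    have h := intervalIntegral.integral_eq_sub_of_hasDerivAt
      (f := fun σ' => UnboundedOperators.heatExtension g (τ + σ') x)
      (f' := fun σ => UnboundedOperators.heatExtension (Δ g) (τ + σ) x) (a := 0) (b := L)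
      (fun σ hσ => hderiv σ (by rw [uIcc_of_le hL] at hσ; exact hσ.1) x)
      (hcont.intervalIntegrable_of_Icc hL)
    rw [h, add_zero]
  -- integrability of `x ↦ G x * e^{sΔ}h x` for integrable `h`
  have hGi : ∀ s, 0 < s → ∀ h : E → ℝ, Integrable h →
      Integrable (fun x => G x * UnboundedOperators.heatExtension h s x) := fun s hs h hh =>
    (UnboundedOperators.integrable_heatExtension hh hs).mul_of_top_right hG
  have hgint : Integrable g := hg2.continuous.integrable_of_hasCompactSupport hgc
  -- Fubini on `E × (0, L]`: `P(τ + L) - P(τ) = ∫₀ᴸ V`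
  set P : ℝ → ℝ := fun s => ∫ x, G x * UnboundedOperators.heatExtension g s x with hP
  set V : ℝ → ℝ := fun σ => ∫ x, G x * UnboundedOperators.heatExtension (Δ g) (τ + σ) x with hVdef
  have hV' : IntegrableOn V (Ioi 0) := by
    simp_rw [hW] at hV
    exact hV
  have hClaim : ∀ L, 0 < L → P (τ + L) - P τ = ∫ σ in (0:ℝ)..L, V σ := by
    intro L hL
    -- joint measurability of the integrand on `E × (0, L]`
    have hc := UnboundedOperators.continuousOn_uncurry_heatExtension_of_memLp hΔgm le_top
    have hc2 : ContinuousOn (fun z : E × ℝ => UnboundedOperators.heatExtension (Δ g) (τ + z.2) z.1)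
        (univ ×ˢ Ioc (0:ℝ) L) :=
      hc.comp (f := fun z : E × ℝ => ((τ + z.2, z.1) : ℝ × E))
        ((continuous_const.add continuous_snd).prodMk continuous_fst).continuousOn
        (fun z hz => mk_mem_prod (show τ + z.2 ∈ Ioi 0 from by
          have : 0 < z.2 := (mem_prod.1 hz).2.1
          simp only [mem_Ioi]; linarith) (mem_univ _))
    have hmeasSet : MeasurableSet (univ ×ˢ Ioc (0:ℝ) L : Set (E × ℝ)) :=
      MeasurableSet.univ.prod measurableSet_Ioc
    have hmH : AEStronglyMeasurable (fun z : E × ℝ => UnboundedOperators.heatExtension (Δ g) (τ + z.2) z.1)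
        ((volume : Measure E).prod (volume.restrict (Ioc (0:ℝ) L))) := by
      have h := hc2.aestronglyMeasurable (μ := (volume : Measure E).prod (volume : Measure ℝ)) hmeasSet
      rw [← Measure.prod_restrict, Measure.restrict_univ] at h
      exact h
    have hm : AEStronglyMeasurable (fun z : E × ℝ => G z.1 * UnboundedOperators.heatExtension (Δ g) (τ + z.2) z.1)
        ((volume : Measure E).prod (volume.restrict (Ioc (0:ℝ) L))) := hG.1.comp_fst.mul hmH
    have hprod : Integrable (fun z : E × ℝ => G z.1 * UnboundedOperators.heatExtension (Δ g) (τ + z.2) z.1)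
        ((volume : Measure E).prod (volume.restrict (Ioc (0:ℝ) L))) := by
      refine (integrable_prod_iff' hm).2 ⟨?_, ?_⟩
      · refine (ae_restrict_iff' measurableSet_Ioc).2 (Eventually.of_forall fun σ hσ => ?_)
        exact hGi (τ + σ) (by linarith [hσ.1]) _ hΔgint
      · have hbound : ∀ σ ∈ Ioc (0:ℝ) L, ‖∫ x, ‖G x * UnboundedOperators.heatExtension (Δ g) (τ + σ) x‖‖ ≤
            (eLpNorm G ∞ volume).toReal * ∫ x, ‖Δ g x‖ := by
          intro σ hσ
          have hs : 0 < τ + σ := by linarith [hσ.1]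
          rw [Real.norm_of_nonneg (integral_nonneg fun _ => norm_nonneg _)]
          refine (integral_norm_mul_le_of_top hG (UnboundedOperators.integrable_heatExtension hΔgint hs)).trans ?_
          exact mul_le_mul_of_nonneg_left (integral_norm_heatExtension_le_of_integrable hΔgint hs) ENNReal.toReal_nonneg
        refine Integrable.mono' (g := fun _ => (eLpNorm G ∞ volume).toReal * ∫ x, ‖Δ g x‖) ?_
          hm.norm.prod_swap.integral_prod_right' ?_
        · exact integrableOn_const (hs := measure_Ioc_lt_top.ne)
        · exact (ae_restrict_iff' measurableSet_Ioc).2 (Eventually.of_forall hbound)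
    -- the two sides
    have hsub : P (τ + L) - P τ = ∫ x, G x * (UnboundedOperators.heatExtension g (τ + L) x -
        UnboundedOperators.heatExtension g τ x) := by
      rw [hP]
      dsimp only
      rw [← integral_sub (hGi _ (by linarith) g hgint) (hGi _ hτ g hgint)]
      refine integral_congr_ae (Eventually.of_forall fun x => ?_)
      ring
    rw [hsub]
    simp_rw [hFTC L hL.le]
    rw [intervalIntegral.integral_of_le hL.le]
    have hswap := integral_integral_swap
      (f := fun (x : E) (σ : ℝ) => G x * UnboundedOperators.heatExtension (Δ g) (τ + σ) x) hprod
    calc ∫ x, G x * ∫ σ in (0:ℝ)..L, UnboundedOperators.heatExtension (Δ g) (τ + σ) x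
        = ∫ x, ∫ σ in Ioc (0:ℝ) L, G x * UnboundedOperators.heatExtension (Δ g) (τ + σ) x := by
          refine integral_congr_ae (Eventually.of_forall fun x => ?_)
          dsimp only
          rw [intervalIntegral.integral_of_le hL.le, ← MeasureTheory.integral_const_mul]
      _ = ∫ σ in Ioc (0:ℝ) L, ∫ x, G x * UnboundedOperators.heatExtension (Δ g) (τ + σ) x := hswap
  -- `P(τ + L) → 0` as `L → ∞`
  have hPto : Tendsto (fun L => P (τ + L)) atTop (𝓝 0) := by
    have hbd : ∀ L, 0 < L → ‖P (τ + L)‖ ≤ (eLpNorm G ∞ volume).toReal * (18 * (τ + L)⁻¹ * ∫ x, ‖θ x‖) := by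
      intro L hL
      have hs : 0 < τ + L := by linarith
      rw [hP]
      dsimp only
      rw [← hU]
      refine (norm_integral_mul_le_of_top hG ?_).trans ?_
      · rw [hU]; exact UnboundedOperators.integrable_heatExtension hgint hs
      · exact mul_le_mul_of_nonneg_left (integral_norm_heatD2_frame_le hE hθi hs j k) ENNReal.toReal_nonneg
    have hlim : Tendsto (fun L : ℝ => (eLpNorm G ∞ volume).toReal * (18 * (τ + L)⁻¹ * ∫ x, ‖θ x‖))
        atTop (𝓝 0) := by
      have h1 : Tendsto (fun L : ℝ => (τ + L)⁻¹) atTop (𝓝 0) :=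
        tendsto_inv_atTop_zero.comp (tendsto_atTop_add_const_left atTop τ tendsto_id)
      have : Tendsto (fun L : ℝ => (eLpNorm G ∞ volume).toReal * (18 * (τ + L)⁻¹ * ∫ x, ‖θ x‖))
          atTop (𝓝 ((eLpNorm G ∞ volume).toReal * (18 * 0 * ∫ x, ‖θ x‖))) :=
        ((h1.const_mul 18).mul_const _).const_mul _
      simpa using this
    refine squeeze_zero_norm' ?_ hlim
    filter_upwards [eventually_gt_atTop 0] with L hL using hbd L hL
  -- pass to the limit `L → ∞` in `∫₀ᴸ V = P(τ+L) - P(τ)`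
  have hT1 : Tendsto (fun L => ∫ σ in (0:ℝ)..L, V σ) atTop (𝓝 (∫ σ in Ioi (0:ℝ), V σ)) :=
    intervalIntegral_tendsto_integral_Ioi 0 hV' tendsto_id
  have hT2 : Tendsto (fun L => ∫ σ in (0:ℝ)..L, V σ) atTop (𝓝 (0 - P τ)) := by
    have h := hPto.sub_const (P τ)
    refine h.congr' ?_
    filter_upwards [eventually_gt_atTop 0] with L hL using hClaim L hL
  have hlimit := tendsto_nhds_unique hT1 hT2
  -- rewrite both sides
  have hLHS : ∫ σ in Ioi (0:ℝ), ∫ x, G x * heatD2 (τ + σ) (b k) (b j) (Δ θ) x = ∫ σ in Ioi (0:ℝ), V σ := by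
    simp_rw [hW]
    rfl
  rw [hLHS, hlimit, zero_sub, hP]
  simp_rw [hU]


/-- **The Oseen–heat operator is weakly divergence free**: for a bounded matrix field `F`,
`τ > 0` and a smooth compactly supported scalar `θ`, `∫ ∑ᵢ (𝒩_τ F)ᵢ ∂ᵢθ = 0`, i.e.
`div (e^{τΔ} P ∇·F) = 0` in the sense of distributions. The first-order layers give
`-∑ⱼₖ ∫ Fⱼₖ ∂ⱼ∂ₖ e^{τΔ}θ` and the Leray correction gives, after integrating out the correction
time with the heat equation (`integral_Ioi_integral_mul_heatD2_laplacian`),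
`+∑ⱼₖ ∫ Fⱼₖ ∂ₖ∂ⱼ e^{τΔ}θ`; the two cancel by the symmetry of second derivatives. This is the
statement that the range of `P` is solenoidal (Lemarié-Rieusset 2016, §6.2, the Oseen tensor
`O_{jk} = δ_{jk}W + G ∗ ∂ⱼ∂ₖW`; Koch–Nadirashvili–Seregin–Šverák 2009, §3: `div u = 0` for the mild
solution (3.3) of the linear Stokes problem). [cite: LemarieRieusset2016, §6.2] -/
theorem integral_sum_oseenHeat_mul_fderiv_eq_zero
    {F : Fin (Module.finrank ℝ E) → Fin (Module.finrank ℝ E) → E → ℝ}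
    (hF : ∀ j k, MemLp (F j k) ∞ volume) {τ : ℝ}
    (hτ : 0 < τ) {θ : E → ℝ} (hθ : FunctionSpaces.IsTestFunctionOn (⊤ : TopologicalSpace.Opens E) θ) :
    ∫ x, ∑ i, oseenHeat τ F i x * fderiv ℝ θ x (stdOrthonormalBasis ℝ E i) = 0 := by
  set b := stdOrthonormalBasis ℝ E with hb
  have hθ1 : ContDiff ℝ 1 θ := contDiff_infty.1 hθ.contDiff 1
  have hθ2 : ContDiff ℝ 2 θ := contDiff_infty.1 hθ.contDiff 2
  have hhs : ∀ i, ContDiff ℝ 1 fun x => fderiv ℝ θ x (b i) := fun i =>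
    contDiff_fderiv_apply_const_of_succ hθ2 (b i)
  have hhc : ∀ i, HasCompactSupport fun x => fderiv ℝ θ x (b i) := fun i =>
    hθ.hasCompactSupport.fderiv_apply ℝ (b i)
  have hhi : ∀ i, Integrable fun x => fderiv ℝ θ x (b i) := fun i =>
    (hhs i).continuous.integrable_of_hasCompactSupport (hhc i)
  -- integrability of the pieces
  have hA : ∀ i j, Integrable (fun x => heatD1 τ (b j) (F j i) x * fderiv ℝ θ x (b i)) := fun i j =>
    (hhi i).mul_of_top_right (memLp_heatD1 (hF j i) le_top hτ (b j))
  have hB : ∀ i j k, Integrable (fun x => (∫ σ in Ioi (0:ℝ),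
      heatD3 (τ + σ) (b i) (b j) (b k) (F j k) x) * fderiv ℝ θ x (b i)) := fun i j k =>
    (hhi i).mul_of_top_right (memLp_top_integral_Ioi_heatD3 hE (hF j k) hτ i j k)
  have hBsum : ∀ i j, Integrable (fun x => ∑ k, (∫ σ in Ioi (0:ℝ),
      heatD3 (τ + σ) (b i) (b j) (b k) (F j k) x) * fderiv ℝ θ x (b i)) := fun i j =>
    integrable_finsetSum _ fun k _ => hB i j k
  -- expand `oseenHeat` and distribute the integral
  have hsplit : ∀ i, ∫ x, oseenHeat τ F i x * fderiv ℝ θ x (b i) =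
      (∑ j, ∫ x, heatD1 τ (b j) (F j i) x * fderiv ℝ θ x (b i)) +
        ∑ j, ∑ k, ∫ x, (∫ σ in Ioi (0:ℝ), heatD3 (τ + σ) (b i) (b j) (b k) (F j k) x) *
          fderiv ℝ θ x (b i) := by
    intro i
    have hpt : ∀ x, oseenHeat τ F i x * fderiv ℝ θ x (b i) =
        (∑ j, heatD1 τ (b j) (F j i) x * fderiv ℝ θ x (b i)) +
          ∑ j, ∑ k, (∫ σ in Ioi (0:ℝ), heatD3 (τ + σ) (b i) (b j) (b k) (F j k) x) *
            fderiv ℝ θ x (b i) := fun x => by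
      simp only [oseenHeat, hb, add_mul, Finset.sum_mul]
    simp_rw [hpt]
    rw [integral_add (integrable_finsetSum _ fun j _ => hA i j)
      (integrable_finsetSum _ fun j _ => hBsum i j),
      MeasureTheory.integral_finsetSum _ fun j _ => hA i j,
      MeasureTheory.integral_finsetSum _ fun j _ => hBsum i j]
    congr 1
    exact Finset.sum_congr rfl fun j _ => MeasureTheory.integral_finsetSum _ fun k _ => hB i j k
  have hOi : ∀ i, Integrable (fun x => oseenHeat τ F i x * fderiv ℝ θ x (b i)) := fun i =>
    (hhi i).mul_of_top_right (memLp_top_oseenHeat hE hF hτ i)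
  rw [MeasureTheory.integral_finsetSum _ fun i _ => hOi i]
  simp_rw [hsplit]
  rw [Finset.sum_add_distrib]
  -- the first-order layers: `∫ ∂ⱼe^{τΔ}Fⱼᵢ ∂ᵢθ = -∫ Fⱼᵢ ∂ⱼ∂ᵢ e^{τΔ}θ`
  have hT1 : ∀ i j, ∫ x, heatD1 τ (b j) (F j i) x * fderiv ℝ θ x (b i) =
      -∫ x, F j i x * heatD2 τ (b j) (b i) θ x := fun i j => by
    rw [integral_heatD1_mul_eq_neg_integral (hF j i) (hhi i) hτ (b j),
      heatD1_fderiv_eq_heatD2 hθ1 hθ.hasCompactSupport τ (b i) (b j)]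
  simp_rw [hT1]
  -- the Leray correction: Fubini in `(σ, x)`, the layer identity and the `σ`-integration
  have hFub : ∀ i j k, ∫ x, (∫ σ in Ioi (0:ℝ), heatD3 (τ + σ) (b i) (b j) (b k) (F j k) x) *
      fderiv ℝ θ x (b i) = ∫ σ in Ioi (0:ℝ), ∫ x, heatD3 (τ + σ) (b i) (b j) (b k) (F j k) x *
        fderiv ℝ θ x (b i) := fun i j k =>
    (integral_integral_Ioi_heatD3_mul_eq hE (hF j k) hτ (hhi i) i j k).2
  have hJ : ∀ i j k, Integrable (fun σ => ∫ x, heatD3 (τ + σ) (b i) (b j) (b k) (F j k) x *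
      fderiv ℝ θ x (b i)) (volume.restrict (Ioi 0)) := fun i j k =>
    (integral_integral_Ioi_heatD3_mul_eq hE (hF j k) hτ (hhi i) i j k).1
  have hT3 : ∀ j k, ∑ i, ∫ x, (∫ σ in Ioi (0:ℝ), heatD3 (τ + σ) (b i) (b j) (b k) (F j k) x) *
      fderiv ℝ θ x (b i) = ∫ x, F j k x * heatD2 τ (b k) (b j) θ x := by
    intro j k
    simp_rw [hFub]
    rw [← MeasureTheory.integral_finsetSum _ fun i _ => hJ i j k]
    -- the layer identity for `σ > 0`
    have hlayer : ∀ σ ∈ Ioi (0:ℝ), ∑ i, ∫ x, heatD3 (τ + σ) (b i) (b j) (b k) (F j k) x *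
        fderiv ℝ θ x (b i) = -∫ x, F j k x * heatD2 (τ + σ) (b k) (b j) (Δ θ) x := fun σ hσ => by
      have hσ' : (0 : ℝ) < σ := hσ
      exact sum_integral_heatD3_mul_fderiv_eq hF (by linarith) hθ j k
    rw [setIntegral_congr_fun measurableSet_Ioi hlayer, MeasureTheory.integral_neg]
    -- integrability of the `σ`-integrand, from that of the layers
    have hV : IntegrableOn (fun σ => ∫ x, F j k x * heatD2 (τ + σ) (b k) (b j) (Δ θ) x) (Ioi 0) := by
      have hsum : IntegrableOn (fun σ => -∑ i, ∫ x, heatD3 (τ + σ) (b i) (b j) (b k) (F j k) x *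
          fderiv ℝ θ x (b i)) (Ioi 0) := (integrable_finsetSum _ fun i _ => hJ i j k).neg
      refine hsum.congr_fun (fun σ hσ => ?_) measurableSet_Ioi
      dsimp only
      rw [hlayer σ hσ, neg_neg]
    rw [integral_Ioi_integral_mul_heatD2_laplacian hE (hF j k) hτ hθ j k hV, neg_neg]
  have hsecond : (∑ i, ∑ j, ∑ k, ∫ x, (∫ σ in Ioi (0:ℝ),
      heatD3 (τ + σ) (b i) (b j) (b k) (F j k) x) * fderiv ℝ θ x (b i)) =
      ∑ j, ∑ k, ∫ x, F j k x * heatD2 τ (b k) (b j) θ x := by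
    rw [Finset.sum_comm]
    refine Finset.sum_congr rfl fun j _ => ?_
    rw [Finset.sum_comm]
    exact Finset.sum_congr rfl fun k _ => hT3 j k
  have hfirst : (∑ i, ∑ j, -∫ x, F j i x * heatD2 τ (b j) (b i) θ x) =
      ∑ j, ∑ k, -∫ x, F j k x * heatD2 τ (b j) (b k) θ x := by
    rw [Finset.sum_comm]
  rw [hsecond, hfirst, ← Finset.sum_add_distrib]
  -- cancellation by the symmetry of second derivatives
  refine Finset.sum_eq_zero fun j _ => ?_
  rw [← Finset.sum_add_distrib]
  refine Finset.sum_eq_zero fun k _ => ?_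
  have hsym : heatD2 τ (b j) (b k) θ = heatD2 τ (b k) (b j) θ :=
    funext fun x => heatD2_comm_of_test hθ2 hθ.hasCompactSupport τ (b j) (b k) x
  rw [hsym]
  ring

end DivFree

end Literature.Analysis.FluidPDE
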